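import Summits.BirchSwinnertonDyer.Rank1Residual.Supersingular.RankOneKimLevelKRecordShapeX7
import Summits.BirchSwinnertonDyer.Rank1Residual.Supersingular.IntModelMinimalityKrausTwoMore
import Summits.BirchSwinnertonDyer.Rank1Residual.Supersingular.RankOneSurjThreeCertificates_12
import HarnessLib

/-!
# Rank ONE at `p = 3`, `#Ш_an = 9`, `3 ∤ ∏c_ℓ`: per-pair RECORDS in the Kim-PRE level-27 currency — `BSD(E,3)` from ONE
# PRIME-level Kurihara number `δ̃_ℓ ≢ 0 (mod 27)` at a cyclic `ℓ ∈ 𝒫_3` (iw-2 ENGINE K v1.3 depth-3, population R1k3) and the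
# two-engine descent count `9 ∣ #Sel^(3)(E/ℚ)`, every side condition DECIDED in the kernel (cell `b2b-bsdres`, supersingular family
# prover B = unit `b2b-bsdres-additive-p3`, gen 23; class lead N6·O3, X7 joint B side; part X7E: 4 of 33 rows)

HONEST FRAMING (cell `b2b-bsdres-*`, verbatim): prove what is provable now; shrink each hard class to its core with data;
no claim beyond stated classes; COMBINATION classes deleted from PUBLISHED theorems only, CONSTRUCTION-shaped remainder
typed; this is not "finishing BSD". X7 / X8 stay CONSTRUCTION-SHAPED; NOT class theorems; nothing is booked; O3's / O4's marks
do not move. EVERY theorem below is CONDITIONAL on the ANNOUNCED preprint C.-H. Kim (app. R. Pollack), arXiv:2505.09121 Thm. 1.1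
(`hK25s`, OPEN binder) and takes AS BINDERS (i) the non-vanishing `kuriharaNumber D.f 27 ℓ ψ ≠ 0` of ONE level-27 Kurihara number
for a surjective `ψ_ℓ : (ℤ/ℓ)ˣ → ℤ/27` — the kernel does NOT compute that number; iw-2's ENGINE K v1.3 did (EVIDENCE:
`HOME/b2b-bsdres-iw-2/ENGINE-K-P9.md` §4 GEN 12 (D), `tables/engKp9_{pairs,levels}.tsv`; twisted `L`-values by the approximate functional
equation, certificates feq / round_resid / dft per level; ONE engine at depth 3 on these rows) — and (ii) the descent count
`9 ∣ #Sel^(3)(E/ℚ)` = gen 19's TWO-ENGINE exact 3-descent (`dim Sel₃ = 3` on both engines; x11b engine 1 / x10b engine 2, kit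
j132399+j136163+j136262 / j132400+j136164+j136263; `HOME/b2b-bsdres-additive-p3/g19/sha9core/R1SHA2-TABLE.md`). Population R1k3 =
r_an 1, X7/X8, surj(3), `v₃(∏c) + v₃(#Ш_an) = 2`, `q = 27`, `ν = 1`: 1 791 rows, 1 666 decided with `min ord₃ δ̃^{(3)} = 2` = Kim's
expected depth; the 33 rows here are the `#Ш_an = 9`, `3 ∤ ∏c` cells OPEN at engine-A ROUND 203 (gen-20 census) without a
level-27 record yet: O4@3 32, O3 1 (gen 21's `RankOneKimLevel27RecordsX8A/B` hold the other 19 O3 rows).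

WHAT THE KERNEL DECIDES PER ROW (shapes `X7RankOne/X8RankOne.bsdp_three_of_kim2025_OPEN_of_ainvs_of_kuriharaNumber_ne_zero_of_card_selmerGroup_of_countPointsFast`,
`RankOneKimLevelKRecordShapeX7.lean`, into gen 18's `RankOne.bsdp_of_kim2025_OPEN_of_casselsTate_of_kuriharaNumber_ne_zero_of_pow_dvd`,
`k = 3 ≤ 4`, `j = 1`): global minimality of the Cremona model (x11c bounded Kraus / gen-20 criterion₃), `3 ∤ Δ` and `#Ẽ(𝔽₃)` (class
X8: `∈ {1,7}`; class X7: `3 ∣ 4 − #Ẽ(𝔽₃)` plus an additive prime `q ∣ Δ, q ∣ c₄`), `ℓ ≥ 5` prime, `ℓ ∤ Δ`, `ℓ ≡ 1 (mod 27)`, the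
point count `#Ẽ(𝔽_ℓ) = n_ℓ` by prover A's `countPointsFast` (binary modular exponentiation, `decide +kernel`) with `27 ∣ n_ℓ` (so
`ℓ ∈ 𝒫_3`), CYCLICITY `#Ẽ(𝔽_ℓ)[3] ≤ 3` by the cube test `Δ^{(ℓ−1)/3} ≢ 1 (mod ℓ)` (n1011-p15); surj(3) is gen 21's kernel
certificate `surj_x7r1_/surj_x8r1_<label>_3`; the 3-adic tower needs no witness. OTHER BINDERS: `hCT`, `hGZK`, `hmod` PUBLISHED;
`D`; `r_an = 1` and `#Ш_an = q` with `ord₃ q = 2` (Cremona allbsd). READING (class lead / X7 joint B): on these rows BSD₃ holds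
modulo (Kim 2025 refereed) + (the engine's δ̃_ℓ mod 27) + (the two-engine descent count) + published facts — a SECOND conditional
route beside the gen-19/20 rem13 + descent records (tier-D composed citation `hK`). By Cassels–Tate squareness the level-27
number pins `ord₃ #Ш = 2` exactly (`≤ 2` from Kim's clause at `k = 3`, `≥ 1` from the descent bit).

References: [Kim2025RefinedTNC] Thm. 1.1 (ANNOUNCED, OPEN binder); [Kim2022StructureSelmer] §1.2.2, Thm. 1.9 (6), Conj. 1.10;
[SilvermanAEC2009] III.1, VII.1, VII.5, X.4.2, X.4.14; [IrelandRosen1990] Prop. 5.1.2; [Kraus1989]; [Cremona1997] §3.6;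
[Cremona2006] Table 1; [Miller2011LMS] Def. 1.1.
-/

set_option autoImplicit false

noncomputable section

open scoped Classical MatrixGroups ModularForm

open CongruenceSubgroup WeierstrassCurve Literature.NumberTheory.EllipticCurves
  Literature.NumberTheory.EllipticCurves.ModularForms
  Literature.NumberTheory.EllipticCurves.Rank1Residual
  Literature.NumberTheory.EllipticCurves.Rank1Residual.Typed
  Literature.NumberTheory.EllipticCurves.Rank1Residual.X11RankOneCertificates
  Summit.BirchSwinnertonDyer.BirchSwinnertonDyer.Rank1Residual.X11RankOne

namespace Summit.BirchSwinnertonDyer.Rank1Residual.Supersingular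

/-- **`471472f1`** (O4@3 = X7@3 ∧ `r_an = 1`; Cremona model `[0, 0, 0, -78091424, 265615451888]`, `N = 471472` = 2^4·79·373, `#Ш_an = 9`, `∏c_ℓ = 7` (`3`-unit: the expected depth is `k = ord₃ #Ш + 1 = 3`), `#E(ℚ)_tors = 1`): `BSD(E,3)` from the level-27 Kurihara number at the prime `ℓ = 8803 ∈ 𝒫_3` — KERNEL: `ℓ ≡ 1 (mod 27)`, `#Ẽ(𝔽_{8803}) = 8883` (`countPointsFast`; `a_ℓ = -79 ≡ ℓ + 1 (mod 27)`), cube test `Δ^{(ℓ−1)/3} ≡ 988 ≢ 1 (mod 8803)` (cyclic `3`-part; engine K: `Ẽ(𝔽_ℓ) ≅ ℤ/8883`, `#Ẽ[3] = 3`), class X7 (`#Ẽ(𝔽₃) = 4`, additive at `2`), minimality, surj(3) (`surj_x7r1_471472f1_3`); BINDER `hδ`: iw-2 ENGINE K v1.3 depth-3 (population R1k3, `tables/engKp9_levels.tsv`, kit j140817; ONE engine at this level; certificates feq ≤ 3.4e-15, round_resid ≤ 1.7e-13, dft ≤ 1.3e-12, D = 1): `δ̃_ℓ ≡ 18 (mod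 27)` (tower [0, 0, 18], `ord₃ = 2 < 3`); all levels run (ℓ:δ̃ mod 27) 3457:0, 3511:0, 8803:18. Non-vanishing mod 27 does not depend on the surjective `ψ_ℓ` (ν = 1: a change of `ψ_ℓ` multiplies `δ̃_ℓ` by a unit), so `hδ` is stated for an arbitrary surjective `ψ`. BINDER `hcard` = gen-19 TWO-ENGINE exact 3-descent `dim Sel₃ = 3` (engine 1 GRH(3sat) j136262 / engine 2 LOWERBOUND j136263, dimSha[3]=2; verdict TWO-ENGINE-LOWERBOUND(dim>=3 both; GRH(3sat) / LOWERBOUND); `HOME/b2b-bsdres-additive-p3/g19/sha9core/R1SHA2-TABLE.md`). CONDITIONAL on `hK25s` (OPEN); `hCT`/`hGZK`/`hmod` PUBLISHED; `r_an = 1`, `#Ш_an` Cremona. A SECOND conditional route on this cell beside the gen-19/20 rem13 + descent record (tier-D `hK`). Per pair; nothing booked. [claim: Kim2025RefinedTNC, status: under-review] [cite: Kim2025RefinedTNC, Thm. 1.1 (ANNOUNCED, OPEN binder)] [cite: Kim2022StructureSelmer, §1.2.2] [cite: SilvermanAEC2009, Thm. X.4.2(a) and Thm. X.4.14] [cite: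 Cremona2006, Table 1 (Cremona label 471472f1)] -/
theorem bsdp_x7r1kim27_471472f1
    (hK25s : Kim2025.thm11_kimShaLength_of_integralPeriod_OPEN)
    (hCT : exists_casselsTate_pairing (K := ℚ))
    (hGZK : rank_eq_analyticRank_of_analyticRank_le_one) (hmod : hasEntireLFunction_rat)
    (W : WeierstrassCurve ℚ) (hW : W = ⟨0, 0, 0, -78091424, 265615451888⟩) (hr : W.analyticRank = 1)
    {N : ℕ} [NeZero N] (D : ModularParametrizationData W N)
    (ψ : (ℓ'' : ℕ) → (ZMod ℓ'')ˣ →* Multiplicative (ZMod (3 ^ 3))) (hψ : Function.Surjective (ψ 8803))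
    (hδ : kuriharaNumber D.f (3 ^ 3) 8803 ψ ≠ 0)
    (hcard : 3 ^ 2 ∣ Nat.card (W.selmerGroup ((3 : ℕ) : ℤ)))
    {q : ℚ} (hq : shaAn W = (q : ℂ)) (hv : padicValRat 3 q = 2) : BSDp W 3 := by
  subst hW
  exact X7RankOne.bsdp_three_of_kim2025_OPEN_of_ainvs_of_kuriharaNumber_ne_zero_of_card_selmerGroup_of_countPointsFast
    hK25s hCT hGZK hmod 0 0 0 (-78091424) 265615451888
    (isGloballyMinimal_of_krausCriterion_bounded 0 0 0 (-78091424) 265615451888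
      (by decide +kernel) (by decide +kernel) (by decide +kernel))
    (by decide) (n₃ := 4) (by decide +kernel) (by decide) 2 (by norm_num) (by decide) (by decide)
    surj_x7r1_471472f1_3 hr D (k := 3) (by norm_num) (by norm_num)
    8803 (hℓ := ⟨by norm_num⟩) (by norm_num) (by decide) (by decide) (nℓ := 8883)
    (by decide +kernel)
    (by decide) (by decide +kernel) (by decide +kernel) ψ hψ hδ hcard hq hv

/-- **`480704bq1`** (O4@3 = X7@3 ∧ `r_an = 1`; Cremona model `[0, 0, 0, 267796, -49028432]`, `N = 480704` = 2^6·7·29·37, `#Ш_an = 9`, `∏c_ℓ = 16` (`3`-unit: the expected depth is `k = ord₃ #Ш + 1 = 3`), `#E(ℚ)_tors = 2`): `BSD(E,3)` from the level-27 Kurihara number at the prime `ℓ = 1297 ∈ 𝒫_3` — KERNEL: `ℓ ≡ 1 (mod 27)`, `#Ẽ(𝔽_{1297}) = 1296` (`countPointsFast`; `a_ℓ = 2 ≡ ℓ + 1 (mod 27)`), cube test `Δ^{(ℓ−1)/3} ≡ 365 ≢ 1 (mod 1297)` (cyclic `3`-part; engine K: `Ẽ(𝔽_ℓ) ≅ ℤ/324x4`,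 `#Ẽ[3] = 3`), class X7 (`#Ẽ(𝔽₃) = 4`, additive at `2`), minimality, surj(3) (`surj_x7r1_480704bq1_3`); BINDER `hδ`: iw-2 ENGINE K v1.3 depth-3 (population R1k3, `tables/engKp9_levels.tsv`, kit j140823; ONE engine at this level; certificates feq ≤ 3.5e-15, round_resid ≤ 1.1e-13, dft ≤ 5.7e-13, D = 1): `δ̃_ℓ ≡ 9 (mod 27)` (tower [0, 0, 9], `ord₃ = 2 < 3`); all levels run (ℓ:δ̃ mod 27) 109:0, 1297:9. Non-vanishing mod 27 does not depend on the surjective `ψ_ℓ` (ν = 1: a change of `ψ_ℓ` multiplies `δ̃_ℓ` by a unit), so `hδ` is stated for an arbitrary surjective `ψ`. BINDER `hcard` = gen-19 TWO-ENGINE exact 3-descent `dim Sel₃ = 3` (engine 1 EXACT(bnfcertify1+3sat) j132399 / engine 2 LOWERBOUND j136164, dimSha[3]=2; verdict TWO-ENGINE-LOWERBOUND(dim>=3 both; e1 EXACT / LOWERBOUND); `HOME/b2b-bsdres-additive-p3/g19/sha9core/R1SHA2-TABLE.md`). CONDITIONAL on `hK25s` (OPEN); `hCT`/`hGZK`/`hmod`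 PUBLISHED; `r_an = 1`, `#Ш_an` Cremona. A SECOND conditional route on this cell beside the gen-19/20 rem13 + descent record (tier-D `hK`). Per pair; nothing booked. [claim: Kim2025RefinedTNC, status: under-review] [cite: Kim2025RefinedTNC, Thm. 1.1 (ANNOUNCED, OPEN binder)] [cite: Kim2022StructureSelmer, §1.2.2] [cite: SilvermanAEC2009, Thm. X.4.2(a) and Thm. X.4.14] [cite: Cremona2006, Table 1 (Cremona label 480704bq1)] -/
theorem bsdp_x7r1kim27_480704bq1
    (hK25s : Kim2025.thm11_kimShaLength_of_integralPeriod_OPEN)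
    (hCT : exists_casselsTate_pairing (K := ℚ))
    (hGZK : rank_eq_analyticRank_of_analyticRank_le_one) (hmod : hasEntireLFunction_rat)
    (W : WeierstrassCurve ℚ) (hW : W = ⟨0, 0, 0, 267796, -49028432⟩) (hr : W.analyticRank = 1)
    {N : ℕ} [NeZero N] (D : ModularParametrizationData W N)
    (ψ : (ℓ'' : ℕ) → (ZMod ℓ'')ˣ →* Multiplicative (ZMod (3 ^ 3))) (hψ : Function.Surjective (ψ 1297))
    (hδ : kuriharaNumber D.f (3 ^ 3) 1297 ψ ≠ 0)
    (hcard : 3 ^ 2 ∣ Nat.card (W.selmerGroup ((3 : ℕ) : ℤ)))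
    {q : ℚ} (hq : shaAn W = (q : ℂ)) (hv : padicValRat 3 q = 2) : BSDp W 3 := by
  subst hW
  exact X7RankOne.bsdp_three_of_kim2025_OPEN_of_ainvs_of_kuriharaNumber_ne_zero_of_card_selmerGroup_of_countPointsFast
    hK25s hCT hGZK hmod 0 0 0 267796 (-49028432)
    (isGloballyMinimal_of_krausCriterion_bounded 0 0 0 267796 (-49028432)
      (by decide +kernel) (by decide +kernel) (by decide +kernel))
    (by decide) (n₃ := 4) (by decide +kernel) (by decide) 2 (by norm_num) (by decide) (by decide)
    surj_x7r1_480704bq1_3 hr D (k := 3) (by norm_num) (by norm_num)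
    1297 (hℓ := ⟨by norm_num⟩) (by norm_num) (by decide) (by decide) (nℓ := 1296)
    (by decide +kernel)
    (by decide) (by decide +kernel) (by decide +kernel) ψ hψ hδ hcard hq hv

/-- **`486560e1`** (O4@3 = X7@3 ∧ `r_an = 1`; Cremona model `[0, 0, 0, -4013, -97812]`, `N = 486560` = 2^5·5·3041, `#Ш_an = 9`, `∏c_ℓ = 4` (`3`-unit: the expected depth is `k = ord₃ #Ш + 1 = 3`), `#E(ℚ)_tors = 2`): `BSD(E,3)` from the level-27 Kurihara number at the prime `ℓ = 757 ∈ 𝒫_3` — KERNEL: `ℓ ≡ 1 (mod 27)`, `#Ẽ(𝔽_{757}) = 756` (`countPointsFast`; `a_ℓ = 2 ≡ ℓ + 1 (mod 27)`), cube test `Δ^{(ℓ−1)/3} ≡ 729 ≢ 1 (mod 757)` (cyclic `3`-part; engine K: `Ẽ(𝔽_ℓ) ≅ ℤ/378x2`, `#Ẽ[3] = 3`), class X7 (`#Ẽ(𝔽₃) = 4`, additive at `2`), minimality, surj(3) (`surj_x7r1_486560e1_3`); BINDER `hδ`: iw-2 ENGINE K v1.3 depth-3 (population R1k3, `tables/engKp9_levels.tsv`,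 kit j140809; ONE engine at this level; certificates feq ≤ 3.1e-15, round_resid ≤ 5.7e-14, dft ≤ 1.3e-13, D = 1): `δ̃_ℓ ≡ 18 (mod 27)` (tower [0, 0, 18], `ord₃ = 2 < 3`); other non-zero levels ℓ = 4159: δ̃ ≡ 18 (mod 27); all levels run (ℓ:δ̃ mod 27) 757:18, 4159:18. Non-vanishing mod 27 does not depend on the surjective `ψ_ℓ` (ν = 1: a change of `ψ_ℓ` multiplies `δ̃_ℓ` by a unit), so `hδ` is stated for an arbitrary surjective `ψ`. BINDER `hcard` = gen-19 TWO-ENGINE exact 3-descent `dim Sel₃ = 3` (engine 1 GRH(3sat) j136262 / engine 2 LOWERBOUND j136263, dimSha[3]=2; verdict TWO-ENGINE-LOWERBOUND(dim>=3 both; GRH(3sat) / LOWERBOUND); `HOME/b2b-bsdres-additive-p3/g19/sha9core/R1SHA2-TABLE.md`). CONDITIONAL on `hK25s` (OPEN); `hCT`/`hGZK`/`hmod` PUBLISHED; `r_an = 1`, `#Ш_an` Cremona. A SECOND conditional route on this cell beside the gen-19/20 rem13 + descent record (tier-D `hK`). Per pair; nothing booked. [claim: Kim2025RefinedTNC, status: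 under-review] [cite: Kim2025RefinedTNC, Thm. 1.1 (ANNOUNCED, OPEN binder)] [cite: Kim2022StructureSelmer, §1.2.2] [cite: SilvermanAEC2009, Thm. X.4.2(a) and Thm. X.4.14] [cite: Cremona2006, Table 1 (Cremona label 486560e1)] -/
theorem bsdp_x7r1kim27_486560e1
    (hK25s : Kim2025.thm11_kimShaLength_of_integralPeriod_OPEN)
    (hCT : exists_casselsTate_pairing (K := ℚ))
    (hGZK : rank_eq_analyticRank_of_analyticRank_le_one) (hmod : hasEntireLFunction_rat)
    (W : WeierstrassCurve ℚ) (hW : W = ⟨0, 0, 0, -4013, -97812⟩) (hr : W.analyticRank = 1)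
    {N : ℕ} [NeZero N] (D : ModularParametrizationData W N)
    (ψ : (ℓ'' : ℕ) → (ZMod ℓ'')ˣ →* Multiplicative (ZMod (3 ^ 3))) (hψ : Function.Surjective (ψ 757))
    (hδ : kuriharaNumber D.f (3 ^ 3) 757 ψ ≠ 0)
    (hcard : 3 ^ 2 ∣ Nat.card (W.selmerGroup ((3 : ℕ) : ℤ)))
    {q : ℚ} (hq : shaAn W = (q : ℂ)) (hv : padicValRat 3 q = 2) : BSDp W 3 := by
  subst hW
  exact X7RankOne.bsdp_three_of_kim2025_OPEN_of_ainvs_of_kuriharaNumber_ne_zero_of_card_selmerGroup_of_countPointsFast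
    hK25s hCT hGZK hmod 0 0 0 (-4013) (-97812)
    (isGloballyMinimal_of_krausCriterion_bounded 0 0 0 (-4013) (-97812)
      (by decide +kernel) (by decide +kernel) (by decide +kernel))
    (by decide) (n₃ := 4) (by decide +kernel) (by decide) 2 (by norm_num) (by decide) (by decide)
    surj_x7r1_486560e1_3 hr D (k := 3) (by norm_num) (by norm_num)
    757 (hℓ := ⟨by norm_num⟩) (by norm_num) (by decide) (by decide) (nℓ := 756)
    (by decide +kernel)
    (by decide) (by decide +kernel) (by decide +kernel) ψ hψ hδ hcard hq hv

/-- **`493952l1`** (O4@3 = X7@3 ∧ `r_an = 1`; Cremona model `[0, 0, 0, -137405, -19604326]`, `N = 493952` = 2^7·17·227, `#Ш_an = 9`, `∏c_ℓ = 4` (`3`-unit: the expected depth is `k = ord₃ #Ш + 1 = 3`), `#E(ℚ)_tors = 2`): `BSD(E,3)` from the level-27 Kurihara number at the prime `ℓ = 3727 ∈ 𝒫_3` — KERNEL: `ℓ ≡ 1 (mod 27)`, `#Ẽ(𝔽_{3727}) = 3672` (`countPointsFast`; `a_ℓ = 56 ≡ ℓ + 1 (mod 27)`), cube test `Δ^{(ℓ−1)/3}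 ≡ 2538 ≢ 1 (mod 3727)` (cyclic `3`-part; engine K: `Ẽ(𝔽_ℓ) ≅ ℤ/1836x2`, `#Ẽ[3] = 3`), class X7 (`#Ẽ(𝔽₃) = 4`, additive at `2`), minimality, surj(3) (`surj_x7r1_493952l1_3`); BINDER `hδ`: iw-2 ENGINE K v1.3 depth-3 (population R1k3, `tables/engKp9_levels.tsv`, kit j140810; ONE engine at this level; certificates feq ≤ 3.3e-15, round_resid ≤ 2.3e-13, dft ≤ 9.7e-13, D = 1): `δ̃_ℓ ≡ 9 (mod 27)` (tower [0, 0, 9], `ord₃ = 2 < 3`); all levels run (ℓ:δ̃ mod 27) 3727:9, 7669:0. Non-vanishing mod 27 does not depend on the surjective `ψ_ℓ` (ν = 1: a change of `ψ_ℓ` multiplies `δ̃_ℓ` by a unit), so `hδ` is stated for an arbitrary surjective `ψ`. BINDER `hcard` = gen-19 TWO-ENGINE exact 3-descent `dim Sel₃ = 3` (engine 1 GRH(3sat) j136262 / engine 2 LOWERBOUND j136263, dimSha[3]=2; verdict TWO-ENGINE-LOWERBOUND(dim>=3 both; GRH(3sat) / LOWERBOUND); `HOME/b2b-bsdres-additive-p3/g19/sha9core/R1SHA2-TABLE.md`).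 CONDITIONAL on `hK25s` (OPEN); `hCT`/`hGZK`/`hmod` PUBLISHED; `r_an = 1`, `#Ш_an` Cremona. A SECOND conditional route on this cell beside the gen-19/20 rem13 + descent record (tier-D `hK`). Per pair; nothing booked. [claim: Kim2025RefinedTNC, status: under-review] [cite: Kim2025RefinedTNC, Thm. 1.1 (ANNOUNCED, OPEN binder)] [cite: Kim2022StructureSelmer, §1.2.2] [cite: SilvermanAEC2009, Thm. X.4.2(a) and Thm. X.4.14] [cite: Cremona2006, Table 1 (Cremona label 493952l1)] -/
theorem bsdp_x7r1kim27_493952l1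
    (hK25s : Kim2025.thm11_kimShaLength_of_integralPeriod_OPEN)
    (hCT : exists_casselsTate_pairing (K := ℚ))
    (hGZK : rank_eq_analyticRank_of_analyticRank_le_one) (hmod : hasEntireLFunction_rat)
    (W : WeierstrassCurve ℚ) (hW : W = ⟨0, 0, 0, -137405, -19604326⟩) (hr : W.analyticRank = 1)
    {N : ℕ} [NeZero N] (D : ModularParametrizationData W N)
    (ψ : (ℓ'' : ℕ) → (ZMod ℓ'')ˣ →* Multiplicative (ZMod (3 ^ 3))) (hψ : Function.Surjective (ψ 3727))
    (hδ : kuriharaNumber D.f (3 ^ 3) 3727 ψ ≠ 0)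
    (hcard : 3 ^ 2 ∣ Nat.card (W.selmerGroup ((3 : ℕ) : ℤ)))
    {q : ℚ} (hq : shaAn W = (q : ℂ)) (hv : padicValRat 3 q = 2) : BSDp W 3 := by
  subst hW
  exact X7RankOne.bsdp_three_of_kim2025_OPEN_of_ainvs_of_kuriharaNumber_ne_zero_of_card_selmerGroup_of_countPointsFast
    hK25s hCT hGZK hmod 0 0 0 (-137405) (-19604326)
    (isGloballyMinimal_of_krausCriterion_bounded 0 0 0 (-137405) (-19604326)
      (by decide +kernel) (by decide +kernel) (by decide +kernel))
    (by decide) (n₃ := 4) (by decide +kernel) (by decide) 2 (by norm_num) (by decide) (by decide)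
    surj_x7r1_493952l1_3 hr D (k := 3) (by norm_num) (by norm_num)
    3727 (hℓ := ⟨by norm_num⟩) (by norm_num) (by decide) (by decide) (nℓ := 3672)
    (by decide +kernel)
    (by decide) (by decide +kernel) (by decide +kernel) ψ hψ hδ hcard hq hv

end Summit.BirchSwinnertonDyer.Rank1Residual.Supersingular

end
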